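import Mathlib
import HarnessLib
import Summits.PneNP.PneNP.Theorems.CnfIdealGenLengthRankDefectRepresentationsLocalCut

/-!
# The SHARP local cut inequality — registered stub `stub_sharpLocalCut` (W19) of line `rank-dehn-ladder`
(crux `RankDefectRepresentations` = stmt-PneNP-18923, RESHAPE 15 of lead g16)

Rows `x : ι` and columns `y : ι'` of a matrix `R` over a field carry colours `row x, col y : Q`.  For a set of
colours `B` write `blk(X, Y) := R ∘ 1[(row ∈ X) × (col ∈ Y)]`, `Qm := blk(B, Bᶜ)`, `Sm := blk(Bᶜ, B)`,
`Pm := blk(B, B)`, `Tm := blk(Bᶜ, Bᶜ)` and `μ(B) := rank Qm + rank Sm` (the bipartition cut of `R` at `B`).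
THEOREM (`stub_sharpLocalCut`, memo `Lines/rank-dehn-ladder-g16.md` §6, the cut lemma with the OPTIMAL constant `2`):
assuming the one-sided PAIR decomposition (the registered statement of stub `stub_oneSidedPair`, W18, taken here as an
explicit hypothesis: a column completion `Pm − Pc = Qm Z + E` AND a row completion `Pm − Pr = Zr Sm + E'` with the JOINT
error bound `rank E + rank E' ≤ μ(B) + ∑_{i ∈ B} δ i`), for EVERY set of colours `B` there is a matrix `R'` supported on
the equal-colour cells `{row x = col y}` with
`2 · rank (R − R') ≤ 4 μ(B) + ∑_{i : Q} (μ(B ∆ {i}) − μ(B))`.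

Proof: put `δ i := μ(B ∆ {i}) − μ(B)`.  The hypothesis at `B` (premise with equality, `…LocalCut.premise_of_mem`) gives
`Pc, Pr, E_P, E'_P, Z_P, Zr_P`; at `Bᶜ` (premise with equality, `…LocalCut.premise_of_mem_compl`; the blocks of `Bᶜ` are
those of `B` exchanged, and `blk(Bᶜ, Bᶜ) = Tm`) it gives `Tc, Tr, E_T, E'_T, Z_T, Zr_T`.  TWO candidates, both supported
on `{row = col}`: the column/column assembly `R'₁ := Pc + Tc` and the row/row assembly `R'₂ := Pr + Tr`.  With
`R = Pm + Qm + Sm + Tm`: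
`R − R'₁ = Qm (1 + Z_P) + Sm (1 + Z_T) + (E_P + E_T)` has rank `≤ μ(B) + rank E_P + rank E_T`, and
`R − R'₂ = (1 + Zr_T) Qm + (1 + Zr_P) Sm + (E'_P + E'_T)` has rank `≤ μ(B) + rank E'_P + rank E'_T`; adding and using
the two joint error bounds, `rank (R − R'₁) + rank (R − R'₂) ≤ 2μ + (μ + ∑_{i∈B} δ i) + (μ + ∑_{i∉B} δ i) = 4μ + ∑_i δ i`,
and the cheaper candidate satisfies `2 · rank ≤` that sum.
HONEST FRAMING: an elementary linear-algebra tool of the AVERAGE-CUT lane; P ≠ NP is not moved; F-N2 is a FRONTIER formal rung.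
-/

set_option linter.dupNamespace false -- `Summit.PneNP.PneNP.…`: summit = sub-problem name (D-0017)

namespace Summit.PneNP.PneNP.Theorems.CnfIdealGenLengthRankDefectRepresentationsSharpLocalCut

open Finset Matrix
open Literature.Computability.AlgebraicComplexity (rank_add_le)
open Summit.PneNP.PneNP.Theorems.CnfIdealGenLengthRankDefectRepresentationsLocalCut
  (premise_of_mem premise_of_mem_compl)

variable {K : Type} [Field K]
variable {ι ι' Q : Type} [Fintype ι] [Fintype ι'] [DecidableEq Q]

/-- COLUMN/COLUMN ASSEMBLY COST.  `rank (Qm (1 + Z) + Sm (1 + Z') + (E + E')) ≤ rank Qm + rank Sm + rank E + rank E'`: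
right multiplication does not increase the rank (`Matrix.rank_mul_le_left`) and the rank is subadditive. [folklore] -/
theorem rank_colAssembly_le [DecidableEq ι'] (Qm Sm E E' : Matrix ι ι' K) (Z Z' : Matrix ι' ι' K) :
    ((Qm * (1 + Z) + Sm * (1 + Z') + (E + E')).rank : ℤ) ≤
      (Qm.rank : ℤ) + (Sm.rank : ℤ) + (E.rank : ℤ) + (E'.rank : ℤ) := by
  have a1 := rank_add_le (Qm * (1 + Z) + Sm * (1 + Z')) (E + E')
  have a2 := rank_add_le (Qm * (1 + Z)) (Sm * (1 + Z'))
  have a3 := rank_add_le E E'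
  have m1 := Matrix.rank_mul_le_left Qm (1 + Z)
  have m2 := Matrix.rank_mul_le_left Sm (1 + Z')
  have h : (Qm * (1 + Z) + Sm * (1 + Z') + (E + E')).rank ≤ Qm.rank + Sm.rank + E.rank + E'.rank := by
    omega
  exact_mod_cast h

/-- ROW/ROW ASSEMBLY COST.  `rank ((1 + Zr) Qm + (1 + Zr') Sm + (E + E')) ≤ rank Qm + rank Sm + rank E + rank E'`:
left multiplication does not increase the rank (`Matrix.rank_mul_le_right`) and the rank is subadditive. [folklore] -/
theorem rank_rowAssembly_le [DecidableEq ι] (Qm Sm E E' : Matrix ι ι' K) (Zr Zr' : Matrix ι ι K) :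
    (((1 + Zr) * Qm + (1 + Zr') * Sm + (E + E')).rank : ℤ) ≤
      (Qm.rank : ℤ) + (Sm.rank : ℤ) + (E.rank : ℤ) + (E'.rank : ℤ) := by
  have a1 := rank_add_le ((1 + Zr) * Qm + (1 + Zr') * Sm) (E + E')
  have a2 := rank_add_le ((1 + Zr) * Qm) ((1 + Zr') * Sm)
  have a3 := rank_add_le E E'
  have m1 := Matrix.rank_mul_le_right (1 + Zr) Qm
  have m2 := Matrix.rank_mul_le_right (1 + Zr') Sm
  have h : ((1 + Zr) * Qm + (1 + Zr') * Sm + (E + E')).rank ≤ Qm.rank + Sm.rank + E.rank + E'.rank := by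
    omega
  exact_mod_cast h

/-- PAIR ASSEMBLY (the pattern of `…LocalCut.assemble` / `…CutLemma.exists_blockDiagonal_of_maxCut`, run twice and
compared).  From a column completion `Pc` and a row completion `Pr` of the super-block `blk(B,B)` (both supported on
`{row = col ∈ B}`, with errors `E_P`, `E'_P` and the joint bound `rank E_P + rank E'_P ≤ μ(B) + ∑_{i∈B} δ i`) and the same
data `Tc, Tr, E_T, E'_T` for `blk(Bᶜ,Bᶜ)` (blocks of the complement written with `Bᶜ`; joint bound with `∑_{i∈Bᶜ} δ i`),
one of the two candidates `Pc + Tc`, `Pr + Tr` — both supported on the equal-colour cells — is within rank `r` of `R` with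
`2 r ≤ 4 μ(B) + ∑_i δ i`: indeed `rank (R − (Pc + Tc)) ≤ μ(B) + rank E_P + rank E_T` (`rank_colAssembly_le`) and
`rank (R − (Pr + Tr)) ≤ μ(B) + rank E'_P + rank E'_T` (`rank_rowAssembly_le`), whose sum is at most `4 μ(B) + ∑_i δ i`.
[folklore] -/
theorem assemble_pair [Fintype Q] [DecidableEq ι] [DecidableEq ι'] (row : ι → Q) (col : ι' → Q) (R : Matrix ι ι' K)
    (B : Finset Q) (δ : Q → ℤ)
    (Pc Pr E_P E'_P : Matrix ι ι' K) (Z_P : Matrix ι' ι' K) (Zr_P : Matrix ι ι K)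
    (hPcs : ∀ x y, ¬ (row x = col y ∧ col y ∈ B) → Pc x y = 0)
    (hPrs : ∀ x y, ¬ (row x = col y ∧ col y ∈ B) → Pr x y = 0)
    (hPc : (Matrix.of fun x y => if row x ∈ B ∧ col y ∈ B then R x y else 0) - Pc =
      (Matrix.of fun x y => if row x ∈ B ∧ col y ∉ B then R x y else 0) * Z_P + E_P)
    (hPr : (Matrix.of fun x y => if row x ∈ B ∧ col y ∈ B then R x y else 0) - Pr =
      Zr_P * (Matrix.of fun x y => if row x ∉ B ∧ col y ∈ B then R x y else 0) + E'_P)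
    (hEP : (E_P.rank : ℤ) + (E'_P.rank : ℤ) ≤
      ((Matrix.of fun x y => if row x ∈ B ∧ col y ∉ B then R x y else 0).rank : ℤ) +
        ((Matrix.of fun x y => if row x ∉ B ∧ col y ∈ B then R x y else 0).rank : ℤ) + ∑ i ∈ B, δ i)
    (Tc Tr E_T E'_T : Matrix ι ι' K) (Z_T : Matrix ι' ι' K) (Zr_T : Matrix ι ι K)
    (hTcs : ∀ x y, ¬ (row x = col y ∧ col y ∈ Bᶜ) → Tc x y = 0)
    (hTrs : ∀ x y, ¬ (row x = col y ∧ col y ∈ Bᶜ) → Tr x y = 0)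
    (hTc : (Matrix.of fun x y => if row x ∈ Bᶜ ∧ col y ∈ Bᶜ then R x y else 0) - Tc =
      (Matrix.of fun x y => if row x ∈ Bᶜ ∧ col y ∉ Bᶜ then R x y else 0) * Z_T + E_T)
    (hTr : (Matrix.of fun x y => if row x ∈ Bᶜ ∧ col y ∈ Bᶜ then R x y else 0) - Tr =
      Zr_T * (Matrix.of fun x y => if row x ∉ Bᶜ ∧ col y ∈ Bᶜ then R x y else 0) + E'_T)
    (hET : (E_T.rank : ℤ) + (E'_T.rank : ℤ) ≤
      ((Matrix.of fun x y => if row x ∈ Bᶜ ∧ col y ∉ Bᶜ then R x y else 0).rank : ℤ) +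
        ((Matrix.of fun x y => if row x ∉ Bᶜ ∧ col y ∈ Bᶜ then R x y else 0).rank : ℤ) + ∑ i ∈ Bᶜ, δ i) :
    ∃ R' : Matrix ι ι' K, (∀ x y, row x ≠ col y → R' x y = 0) ∧
      2 * ((R - R').rank : ℤ) ≤
        4 * (((Matrix.of fun x y => if row x ∈ B ∧ col y ∉ B then R x y else 0).rank : ℤ) +
            ((Matrix.of fun x y => if row x ∉ B ∧ col y ∈ B then R x y else 0).rank : ℤ)) + ∑ i, δ i := by
  set Qm : Matrix ι ι' K := Matrix.of fun x y => if row x ∈ B ∧ col y ∉ B then R x y else 0 with hQm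
  set Sm : Matrix ι ι' K := Matrix.of fun x y => if row x ∉ B ∧ col y ∈ B then R x y else 0 with hSm
  set Pm : Matrix ι ι' K := Matrix.of fun x y => if row x ∈ B ∧ col y ∈ B then R x y else 0 with hPm
  set Tm : Matrix ι ι' K := Matrix.of fun x y => if row x ∈ Bᶜ ∧ col y ∈ Bᶜ then R x y else 0 with hTm
  -- the complement has the same cut, with the two blocks exchanged
  have cQ : (Matrix.of fun x y => if row x ∈ Bᶜ ∧ col y ∉ Bᶜ then R x y else 0) = Sm := by
    ext x y
    simp only [hSm, Matrix.of_apply, Finset.mem_compl, not_not]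
  have cS : (Matrix.of fun x y => if row x ∉ Bᶜ ∧ col y ∈ Bᶜ then R x y else 0) = Qm := by
    ext x y
    simp only [hQm, Matrix.of_apply, Finset.mem_compl, not_not]
  rw [cQ] at hTc
  rw [cS] at hTr
  rw [cQ, cS] at hET
  have hR : R = Pm + Qm + Sm + Tm := by
    ext x y
    simp only [hPm, hQm, hSm, hTm, Matrix.add_apply, Matrix.of_apply, Finset.mem_compl]
    by_cases hx : row x ∈ B <;> by_cases hy : col y ∈ B <;> simp [hx, hy]
  -- candidate 1: the column/column assembly
  have h1 : R - (Pc + Tc) = Qm * (1 + Z_P) + Sm * (1 + Z_T) + (E_P + E_T) := by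
    have e : R - (Pc + Tc) = Qm + Sm + ((Pm - Pc) + (Tm - Tc)) := by
      rw [hR]; abel
    rw [e, hPc, hTc, Matrix.mul_add, Matrix.mul_one, Matrix.mul_add, Matrix.mul_one]
    abel
  -- candidate 2: the row/row assembly
  have h2 : R - (Pr + Tr) = (1 + Zr_T) * Qm + (1 + Zr_P) * Sm + (E'_P + E'_T) := by
    have e : R - (Pr + Tr) = Qm + Sm + ((Pm - Pr) + (Tm - Tr)) := by
      rw [hR]; abel
    rw [e, hPr, hTr, Matrix.add_mul, Matrix.one_mul, Matrix.add_mul, Matrix.one_mul]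
    abel
  have r1 : ((R - (Pc + Tc)).rank : ℤ) ≤ (Qm.rank : ℤ) + (Sm.rank : ℤ) + (E_P.rank : ℤ) + (E_T.rank : ℤ) := by
    rw [h1]
    exact rank_colAssembly_le Qm Sm E_P E_T Z_P Z_T
  have r2 : ((R - (Pr + Tr)).rank : ℤ) ≤ (Qm.rank : ℤ) + (Sm.rank : ℤ) + (E'_P.rank : ℤ) + (E'_T.rank : ℤ) := by
    rw [h2]
    exact rank_rowAssembly_le Qm Sm E'_P E'_T Zr_T Zr_P
  have hsplit : ∑ i ∈ B, δ i + ∑ i ∈ Bᶜ, δ i = ∑ i, δ i := Finset.sum_add_sum_compl B δ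
  by_cases hle : ((R - (Pc + Tc)).rank : ℤ) ≤ ((R - (Pr + Tr)).rank : ℤ)
  · refine ⟨Pc + Tc, fun x y hxy => ?_, ?_⟩
    · rw [Matrix.add_apply, hPcs x y (fun h => hxy h.1), hTcs x y (fun h => hxy h.1), add_zero]
    · linarith
  · refine ⟨Pr + Tr, fun x y hxy => ?_, ?_⟩
    · rw [Matrix.add_apply, hPrs x y (fun h => hxy h.1), hTrs x y (fun h => hxy h.1), add_zero]
    · linarith

/-- **The sharp local cut inequality** — registered stub `stub_sharpLocalCut` (W19) of line `rank-dehn-ladder`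
(crux stmt-PneNP-18923), signature verbatim from the ledger stub record (RESHAPE 15): the one-sided PAIR decomposition
(stub `stub_oneSidedPair`, W18 — the hypothesis) implies that for EVERY set of colours `B` there is a matrix `R'`
supported on the equal-colour cells with `2 · rank (R − R') ≤ 4 μ(B) + ∑_{i : Q} (μ(B ∆ {i}) − μ(B))`.  Proof: the
hypothesis at `B` (`…LocalCut.premise_of_mem`) and at `Bᶜ` (`…LocalCut.premise_of_mem_compl`) with
`δ i := μ(B ∆ {i}) − μ(B)`, then `assemble_pair` (the cheaper of the column/column and row/row assemblies). [folklore] -/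
theorem stub_sharpLocalCut :
    (∀ (K : Type) [Field K] (ι ι' Q : Type) [Fintype ι] [Fintype ι'] [DecidableEq ι] [DecidableEq ι'] [DecidableEq Q]
      (row : ι → Q) (col : ι' → Q) (R : Matrix ι ι' K) (B : Finset Q) (δ : Q → ℤ),
      (∀ i ∈ B,
        (((Matrix.of fun x y => if row x ∈ B.erase i ∧ col y ∉ B.erase i then R x y else 0).rank : ℤ) +
          ((Matrix.of fun x y => if row x ∉ B.erase i ∧ col y ∈ B.erase i then R x y else 0).rank : ℤ)) ≤
        ((Matrix.of fun x y => if row x ∈ B ∧ col y ∉ B then R x y else 0).rank : ℤ) +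
          ((Matrix.of fun x y => if row x ∉ B ∧ col y ∈ B then R x y else 0).rank : ℤ) + δ i) →
      ∃ (Pc Pr E E' : Matrix ι ι' K) (Z : Matrix ι' ι' K) (Zr : Matrix ι ι K),
        (∀ x y, ¬ (row x = col y ∧ col y ∈ B) → Pc x y = 0) ∧
        (∀ x y, ¬ (row x = col y ∧ col y ∈ B) → Pr x y = 0) ∧
        (Matrix.of fun x y => if row x ∈ B ∧ col y ∈ B then R x y else 0) - Pc =
          (Matrix.of fun x y => if row x ∈ B ∧ col y ∉ B then R x y else 0) * Z + E ∧
        (Matrix.of fun x y => if row x ∈ B ∧ col y ∈ B then R x y else 0) - Pr =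
          Zr * (Matrix.of fun x y => if row x ∉ B ∧ col y ∈ B then R x y else 0) + E' ∧
        (E.rank : ℤ) + (E'.rank : ℤ) ≤
          ((Matrix.of fun x y => if row x ∈ B ∧ col y ∉ B then R x y else 0).rank : ℤ) +
            ((Matrix.of fun x y => if row x ∉ B ∧ col y ∈ B then R x y else 0).rank : ℤ) + ∑ i ∈ B, δ i) →
    ∀ (K : Type) [Field K] (ι ι' Q : Type) [Fintype ι] [Fintype ι'] [DecidableEq ι] [DecidableEq ι'] [Fintype Q] [DecidableEq Q]
      (row : ι → Q) (col : ι' → Q) (R : Matrix ι ι' K) (B : Finset Q),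
      ∃ R' : Matrix ι ι' K, (∀ x y, row x ≠ col y → R' x y = 0) ∧
        2 * ((R - R').rank : ℤ) ≤
          4 * (((Matrix.of fun x y => if row x ∈ B ∧ col y ∉ B then R x y else 0).rank : ℤ) +
              ((Matrix.of fun x y => if row x ∉ B ∧ col y ∈ B then R x y else 0).rank : ℤ)) +
          ∑ i : Q, ((((Matrix.of fun x y => if row x ∈ symmDiff B {i} ∧ col y ∉ symmDiff B {i} then R x y else 0).rank : ℤ) +
              ((Matrix.of fun x y => if row x ∉ symmDiff B {i} ∧ col y ∈ symmDiff B {i} then R x y else 0).rank : ℤ)) -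
            (((Matrix.of fun x y => if row x ∈ B ∧ col y ∉ B then R x y else 0).rank : ℤ) +
              ((Matrix.of fun x y => if row x ∉ B ∧ col y ∈ B then R x y else 0).rank : ℤ))) := by
  intro hOP K _ ι ι' Q _ _ _ _ _ _ row col R B
  obtain ⟨Pc, Pr, E_P, E'_P, Z_P, Zr_P, hPcs, hPrs, hPc, hPr, hEP⟩ := hOP K ι ι' Q row col R B
    (fun i => (((Matrix.of fun x y => if row x ∈ symmDiff B {i} ∧ col y ∉ symmDiff B {i} then R x y else 0).rank : ℤ) +
        ((Matrix.of fun x y => if row x ∉ symmDiff B {i} ∧ col y ∈ symmDiff B {i} then R x y else 0).rank : ℤ)) -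
      (((Matrix.of fun x y => if row x ∈ B ∧ col y ∉ B then R x y else 0).rank : ℤ) +
        ((Matrix.of fun x y => if row x ∉ B ∧ col y ∈ B then R x y else 0).rank : ℤ)))
    (fun i hi => premise_of_mem row col R B hi)
  obtain ⟨Tc, Tr, E_T, E'_T, Z_T, Zr_T, hTcs, hTrs, hTc, hTr, hET⟩ := hOP K ι ι' Q row col R Bᶜ
    (fun i => (((Matrix.of fun x y => if row x ∈ symmDiff B {i} ∧ col y ∉ symmDiff B {i} then R x y else 0).rank : ℤ) +
        ((Matrix.of fun x y => if row x ∉ symmDiff B {i} ∧ col y ∈ symmDiff B {i} then R x y else 0).rank : ℤ)) -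
      (((Matrix.of fun x y => if row x ∈ B ∧ col y ∉ B then R x y else 0).rank : ℤ) +
        ((Matrix.of fun x y => if row x ∉ B ∧ col y ∈ B then R x y else 0).rank : ℤ)))
    (fun i hi => premise_of_mem_compl row col R B hi)
  exact assemble_pair row col R B _ Pc Pr E_P E'_P Z_P Zr_P hPcs hPrs hPc hPr hEP
    Tc Tr E_T E'_T Z_T Zr_T hTcs hTrs hTc hTr hET

end Summit.PneNP.PneNP.Theorems.CnfIdealGenLengthRankDefectRepresentationsSharpLocalCut
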